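import Summits.QuantumAdvantage.AdviceFreeQNC0.TransferWalk
import Summits.QuantumAdvantage.AdviceFreeQNC0.FixedBellsSparse
import Summits.QuantumAdvantage.AdviceFreeQNC0.DWalkOneBell
import HarnessLib

/-!
# Cell qa-qnc0 (rung F-Q2-odd, `p = 3`): R0, dense branch — at least 21 fixed bells (ROUND-15 §9.7 (iii))

Planner qa-qnc0-p1 g17, route DWalkThree, support `RingFixedBellsSharp3` (stmt-QuantumAdvantage-22487), dense half:
a FIXED bell set `B ⊆ Fin N` with `#B ≥ 21` wins the ring game on at most `(2/3)·2^{N-1}` odd-class inputs.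

Proof: the twisted-trace form of the signed count (`TransferWalk.signedSum_eq`) is bounded through ten disjoint
pairs of consecutive bells, each pair block contracting `ℓ²` by `5/8` (`TransferOps.nsq_pair_le`), all other cut
operators being contractions: `|Σ_E (seg v_E)(E)| ≤ 3·(5/8)^5 < 1/3`, whence `3·#WIN_u ≤ 2·2^n` in u-coordinates
(`card_winU_dense_le`) and, by `WalkTransport.rel_iff_ringWinU` + `card_odd_filter_le`, on the odd class
(**`fixedBells_dense_le`**).  The elementary chain `|e_E·L·Π·R v| ≤ ∏‖pair‖ ≤ (5/8)^5` replaces operator norms.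

* `chain_bound`, `twisted_entry_sq_le` — the contraction estimate along 21 sorted bells;
* `sign_eq_prod` — `(-1)^{WIN(u)} = ∏_{g ≤ n} bellfactor_g(2 + pos_n + pos_g)`;
* `card_winU_dense_le`, **`fixedBells_dense_le`**.

WHAT THIS IS NOT: the ring-language closer (`Theorems/DWalkThreeRingFixedBellsSharp3.lean`) combines this with
`FixedBellsSparse.fixedBells_sparse_le`; separation NOT moved.
-/

noncomputable section

namespace Summit.QuantumAdvantage.AdviceFreeQNC0

namespace TransferWalk

open Finset Literature.Computability.QuantumComplexity Literature.Computability.QuantumComplexity.RingHLF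
open Literature.Computability.MetaComplexity

/-! ### The contraction estimate along 21 sorted bells -/

section Chain

variable (bell : ℕ → Bool) (K : ℕ → ℕ)

/-- Ten pair blocks: `‖seg_{[K_{20-2s}, K_{20})} w‖² ≤ (5/8)^s ‖w‖²`. -/
theorem chain_bound (hKmono : ∀ i j, i < j → j ≤ 20 → K i < K j) (hKbell : ∀ j, j ≤ 20 → bell (K j) = true)
    (hKgap : ∀ j g, j < 20 → K j < g → g < K (j + 1) → bell g = false) :
    ∀ s, s ≤ 10 → ∀ w : ZMod 3 → ℝ,
      nsq (seg bell (K (20 - 2 * s)) (K 20 - K (20 - 2 * s)) w) ≤ (5 / 8 : ℝ) ^ s * nsq w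
  | 0, _, w => by simp [seg]
  | s + 1, hs, w => by
    obtain ⟨j, hj⟩ : ∃ j, j = 20 - 2 * (s + 1) := ⟨_, rfl⟩
    have hj2 : 20 - 2 * s = j + 2 := by omega
    rw [← hj]
    have h01 : K j < K (j + 1) := hKmono j (j + 1) (by omega) (by omega)
    have h12 : K (j + 1) < K (j + 2) := hKmono (j + 1) (j + 2) (by omega) (by omega)
    have h2e : K (j + 2) ≤ K 20 := by
      rcases Nat.eq_or_lt_of_le (show j + 2 ≤ 20 by omega) with h | h
      · rw [h]
      · exact (hKmono (j + 2) 20 h le_rfl).le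
    -- split off the first pair block
    have hsplit : seg bell (K j) (K 20 - K j) w =
        seg bell (K j) (K (j + 2) - K j) (seg bell (K (j + 2)) (K 20 - K (j + 2)) w) := by
      have h := seg_add bell (K (j + 2) - K j) (K j) (K 20 - K (j + 2)) w
      rw [show K (j + 2) - K j + (K 20 - K (j + 2)) = K 20 - K j by omega,
        show K j + (K (j + 2) - K j) = K (j + 2) by omega] at h
      exact h
    have hpair : seg bell (K j) (K (j + 2) - K j) (seg bell (K (j + 2)) (K 20 - K (j + 2)) w) =
        pairOp (K (j + 1) - K j) (K (j + 2) - K (j + 1)) (seg bell (K (j + 2)) (K 20 - K (j + 2)) w) := by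
      refine seg_pair bell h01 h12 (hKbell j (by omega)) (hKbell (j + 1) (by omega)) ?_ _
      intro g hg1 hg2 hgm
      rcases Nat.lt_or_gt_of_ne hgm with h | h
      · exact hKgap j g (by omega) hg1 h
      · exact hKgap (j + 1) g (by omega) h hg2
    rw [hsplit, hpair]
    have ih := chain_bound hKmono hKbell hKgap s (by omega) w
    rw [hj2] at ih
    calc nsq (pairOp (K (j + 1) - K j) (K (j + 2) - K (j + 1)) (seg bell (K (j + 2)) (K 20 - K (j + 2)) w))
        ≤ 5 / 8 * nsq (seg bell (K (j + 2)) (K 20 - K (j + 2)) w) := nsq_pair_le (by omega) (by omega) _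
      _ ≤ 5 / 8 * ((5 / 8 : ℝ) ^ s * nsq w) := mul_le_mul_of_nonneg_left ih (by norm_num)
      _ = (5 / 8 : ℝ) ^ (s + 1) * nsq w := by ring

/-- **The twisted trace entries are small**: `(seg bell 0 n v_E)(E)² ≤ (5/8)^{10}`. -/
theorem twisted_entry_sq_le {n : ℕ} (hKmono : ∀ i j, i < j → j ≤ 20 → K i < K j)
    (hKbell : ∀ j, j ≤ 20 → bell (K j) = true)
    (hKgap : ∀ j g, j < 20 → K j < g → g < K (j + 1) → bell g = false) (hKn : K 20 ≤ n) (E : ZMod 3) :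
    seg bell 0 n (vE bell n E) E ^ 2 ≤ (5 / 8 : ℝ) ^ 10 := by
  have h020 : K 0 ≤ K 20 := (hKmono 0 20 (by norm_num) le_rfl).le
  have hsplit : seg bell 0 n (vE bell n E) =
      seg bell 0 (K 0) (seg bell (K 0) (K 20 - K 0) (seg bell (K 20) (n - K 20) (vE bell n E))) := by
    have h1 := seg_add bell (K 0) 0 (n - K 0) (vE bell n E)
    rw [show K 0 + (n - K 0) = n by omega, Nat.zero_add] at h1
    have h2 := seg_add bell (K 20 - K 0) (K 0) (n - K 20) (vE bell n E)
    rw [show K 20 - K 0 + (n - K 20) = n - K 0 by omega, show K 0 + (K 20 - K 0) = K 20 by omega] at h2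
    rw [h1, h2]
  rw [hsplit]
  have hc := chain_bound bell K hKmono hKbell hKgap 10 le_rfl (seg bell (K 20) (n - K 20) (vE bell n E))
  rw [show 20 - 2 * 10 = 0 from rfl] at hc
  calc seg bell 0 (K 0) (seg bell (K 0) (K 20 - K 0) (seg bell (K 20) (n - K 20) (vE bell n E))) E ^ 2
      ≤ nsq (seg bell 0 (K 0) (seg bell (K 0) (K 20 - K 0) (seg bell (K 20) (n - K 20) (vE bell n E)))) :=
        sq_le_nsq _ E
    _ ≤ nsq (seg bell (K 0) (K 20 - K 0) (seg bell (K 20) (n - K 20) (vE bell n E))) := nsq_seg_le bell _ _ _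
    _ ≤ (5 / 8 : ℝ) ^ 10 * nsq (seg bell (K 20) (n - K 20) (vE bell n E)) := hc
    _ ≤ (5 / 8 : ℝ) ^ 10 * 1 := by
        refine mul_le_mul_of_nonneg_left ?_ (by positivity)
        exact le_trans (nsq_seg_le bell _ _ _) (nsq_vE_le bell n E)
    _ = (5 / 8 : ℝ) ^ 10 := mul_one _

/-- Hence the twisted trace is `≥ -3·(5/8)^5`. -/
theorem twisted_trace_ge {n : ℕ} (hKmono : ∀ i j, i < j → j ≤ 20 → K i < K j)
    (hKbell : ∀ j, j ≤ 20 → bell (K j) = true)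
    (hKgap : ∀ j g, j < 20 → K j < g → g < K (j + 1) → bell g = false) (hKn : K 20 ≤ n) :
    -(3 * (5 / 8 : ℝ) ^ 5) ≤ ∑ E : ZMod 3, seg bell 0 n (vE bell n E) E := by
  have hE : ∀ E : ZMod 3, -(5 / 8 : ℝ) ^ 5 ≤ seg bell 0 n (vE bell n E) E := by
    intro E
    have h := twisted_entry_sq_le bell K hKmono hKbell hKgap hKn E
    rw [show (5 / 8 : ℝ) ^ 10 = ((5 / 8 : ℝ) ^ 5) ^ 2 by rw [← pow_mul]] at h
    have hc : (0 : ℝ) < (5 / 8 : ℝ) ^ 5 := by positivity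
    by_contra hlt
    rw [not_le] at hlt
    have h1 : 0 < -(5 / 8 : ℝ) ^ 5 - seg bell 0 n (vE bell n E) E := by linarith
    have h2 : 0 < (5 / 8 : ℝ) ^ 5 - seg bell 0 n (vE bell n E) E := by linarith
    nlinarith [mul_pos h1 h2, h]
  have h3 : ∑ E : ZMod 3, seg bell 0 n (vE bell n E) E =
      seg bell 0 n (vE bell n 0) 0 + seg bell 0 n (vE bell n 1) 1 + seg bell 0 n (vE bell n 2) 2 :=
    Fin.sum_univ_three (fun E => seg bell 0 n (vE bell n E) E)
  rw [h3]
  linarith [hE 0, hE 1, hE 2]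

end Chain

/-! ### The count in u-coordinates -/

section Count

variable {n : ℕ}

/-- The total walk weight is the last prefix weight. -/
theorem wt_eq_wtPrefix (u : Fin n → Bool) : wt u = wtPrefix u n := by
  unfold wt wtPrefix
  congr 1; ext i; simp

/-- The ring condition at cut `g` in terms of the walk position. -/
theorem cond_iff (u : Fin n → Bool) (g : ℕ) :
    (n + 2 + g + walkExp u g) % 3 ≠ 0 ↔ (2 : ZMod 3) + posZ u n + posZ u g ≠ 0 := by
  have h : (2 : ZMod 3) + posZ u n + posZ u g = ((n + 2 + g + walkExp u g : ℕ) : ZMod 3) := by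
    unfold posZ walkExp; rw [wt_eq_wtPrefix]; push_cast; ring
  rw [h, Ne, Ne, ZMod.natCast_eq_zero_iff, Nat.dvd_iff_mod_eq_zero]

/-- **Sign identity**: `(-1)^{WIN_B(u)} = ∏_{g ≤ n} bellfactor_g(2 + pos_n(u) + pos_g(u))` for the constant selector
`y_g = [g ∈ B]` and the bell indicator `bell g = [g ∈ B.map val]`. -/
theorem sign_eq_prod (B : Finset (Fin (n + 1))) (u : Fin n → Bool) :
    (if ringWinU (n + 2) (fun (g : Fin (n + 1)) (_ : Fin n → Bool) => decide (g ∈ B)) u = true then (-1 : ℝ) else 1) =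
      ∏ g ∈ range (n + 1), bfz (fun g => decide (g ∈ B.map Fin.valEmbedding)) g (2 + posZ u n + posZ u g) := by
  classical
  -- the product over `Fin (n+1)`
  rw [← Fin.prod_univ_eq_prod_range (fun g => bfz (fun g => decide (g ∈ B.map Fin.valEmbedding)) g
    (2 + posZ u n + posZ u g)) (n + 1)]
  have hfac : ∀ g : Fin (n + 1), bfz (fun g => decide (g ∈ B.map Fin.valEmbedding)) g.val (2 + posZ u n + posZ u g.val) =
      if (g ∈ B ∧ (n + 2 + g.val + walkExp u g.val) % 3 ≠ 0) then (-1 : ℝ) else 1 := by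
    intro g
    have hmem : (g.val ∈ B.map Fin.valEmbedding) ↔ g ∈ B := by
      rw [show g.val = Fin.valEmbedding g from rfl, Finset.mem_map' Fin.valEmbedding]
    unfold bfz fz
    beta_reduce
    by_cases hg : g ∈ B
    · rw [decide_eq_true (hmem.2 hg), if_pos rfl]
      by_cases hc : (n + 2 + g.val + walkExp u g.val) % 3 ≠ 0
      · rw [if_neg ((cond_iff u g.val).1 hc), if_pos ⟨hg, hc⟩]
      · rw [if_pos (not_not.1 fun h => hc ((cond_iff u g.val).2 h)), if_neg (fun h => hc h.2)]
    · rw [show decide (g.val ∈ B.map Fin.valEmbedding) = false from decide_eq_false (fun h => hg (hmem.1 h))]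
      simp [hg]
  simp only [hfac]
  rw [Finset.prod_ite, Finset.prod_const, Finset.prod_const_one, mul_one]
  -- the parity of the number of live bells
  unfold ringWinU
  have hset : (univ.filter fun g : Fin (n + 1) =>
      (fun (g : Fin (n + 1)) (_ : Fin n → Bool) => decide (g ∈ B)) g u = true ∧
        (n + 2 + g.val + walkExp u g.val) % 3 ≠ 0) =
      univ.filter fun g : Fin (n + 1) => g ∈ B ∧ (n + 2 + g.val + walkExp u g.val) % 3 ≠ 0 := by
    ext g; simp only [mem_filter, mem_univ, true_and, decide_eq_true_eq]
  rw [hset]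
  rcases Nat.even_or_odd ((univ.filter fun g : Fin (n + 1) => g ∈ B ∧ (n + 2 + g.val + walkExp u g.val) % 3 ≠ 0).card)
    with h | h
  · rw [h.neg_one_pow]
    have hd : decide (((univ.filter fun g : Fin (n + 1) =>
        g ∈ B ∧ (n + 2 + g.val + walkExp u g.val) % 3 ≠ 0).card) % 2 = 1) = false :=
      decide_eq_false (by rw [Nat.even_iff] at h; omega)
    rw [hd]; simp
  · rw [h.neg_one_pow]
    have hd : decide (((univ.filter fun g : Fin (n + 1) =>
        g ∈ B ∧ (n + 2 + g.val + walkExp u g.val) % 3 ≠ 0).card) % 2 = 1) = true :=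
      decide_eq_true (Nat.odd_iff.1 h)
    rw [hd]; simp

/-- **R0, dense branch, u-coordinates**: a constant selector with `≥ 21` bells wins on at most `(2/3)·2^n` walks. -/
theorem card_winU_dense_le (B : Finset (Fin (n + 1))) (hB : 21 ≤ B.card) :
    3 * ((univ.filter fun u : Fin n → Bool =>
      ringWinU (n + 2) (fun (g : Fin (n + 1)) (_ : Fin n → Bool) => decide (g ∈ B)) u = true).card : ℝ) ≤
      2 * (2 : ℝ) ^ n := by
  classical
  -- sorted bells
  set Bn : Finset ℕ := B.map Fin.valEmbedding with hBn
  have hcard : Bn.card = B.card := Finset.card_map _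
  set bell : ℕ → Bool := fun g => decide (g ∈ Bn) with hbell
  have h21 : 21 ≤ Bn.card := by rw [hcard]; exact hB
  set e := Bn.orderEmbOfFin (rfl : Bn.card = Bn.card) with he
  set K : ℕ → ℕ := fun j => if h : j < Bn.card then e ⟨j, h⟩ else 0 with hK
  have hKe : ∀ j (h : j < Bn.card), K j = e ⟨j, h⟩ := fun j h => by simp only [hK, dif_pos h]
  have hKmem : ∀ j, j < Bn.card → K j ∈ Bn := fun j h => by rw [hKe j h]; exact Finset.orderEmbOfFin_mem _ _ _
  have hKmono : ∀ i j, i < j → j ≤ 20 → K i < K j := by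
    intro i j hij hj
    rw [hKe i (by omega), hKe j (by omega)]
    exact e.strictMono (Fin.mk_lt_mk.2 hij)
  have hKbell : ∀ j, j ≤ 20 → bell (K j) = true := fun j hj => by
    simp only [hbell, decide_eq_true_eq]; exact hKmem j (by omega)
  have hKgap : ∀ j g, j < 20 → K j < g → g < K (j + 1) → bell g = false := by
    intro j g hj h1 h2
    simp only [hbell, decide_eq_false_iff_not]
    intro hg
    have hr : g ∈ Set.range e := by rw [Finset.range_orderEmbOfFin]; exact hg
    obtain ⟨i, hi⟩ := hr
    rw [hKe j (by omega), ← hi] at h1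
    rw [hKe (j + 1) (by omega), ← hi] at h2
    have h1' := e.strictMono.lt_iff_lt.1 h1
    have h2' := e.strictMono.lt_iff_lt.1 h2
    rw [Fin.lt_def] at h1' h2'
    simp only at h1' h2'
    omega
  have hKn : K 20 ≤ n := by
    have hm := hKmem 20 (by omega)
    rw [hBn, Finset.mem_map] at hm
    obtain ⟨k, _, hk⟩ := hm
    have := k.isLt
    rw [← hk]; exact Nat.lt_succ_iff.1 (by exact this)
  -- the signed count
  have htrace := twisted_trace_ge bell K hKmono hKbell hKgap hKn
  have hsigned := signedSum_eq bell n
  have hsign : ∀ u : Fin n → Bool,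
      (if ringWinU (n + 2) (fun (g : Fin (n + 1)) (_ : Fin n → Bool) => decide (g ∈ B)) u = true then (-1 : ℝ) else 1) =
        ∏ g ∈ range (n + 1), bfz bell g (2 + posZ u n + posZ u g) := fun u => sign_eq_prod B u
  -- `Σ_u (-1)^{WIN} = 2^n - 2·#WIN`
  set W := (univ.filter fun u : Fin n → Bool =>
    ringWinU (n + 2) (fun (g : Fin (n + 1)) (_ : Fin n → Bool) => decide (g ∈ B)) u = true) with hW
  have hcount : ∑ u : Fin n → Bool,
      (if ringWinU (n + 2) (fun (g : Fin (n + 1)) (_ : Fin n → Bool) => decide (g ∈ B)) u = true then (-1 : ℝ) else 1) =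
        (2 : ℝ) ^ n - 2 * (W.card : ℝ) := by
    have h1 : ∀ u : Fin n → Bool,
        (if ringWinU (n + 2) (fun (g : Fin (n + 1)) (_ : Fin n → Bool) => decide (g ∈ B)) u = true then (-1 : ℝ) else 1) =
          1 - 2 * (if ringWinU (n + 2) (fun (g : Fin (n + 1)) (_ : Fin n → Bool) => decide (g ∈ B)) u = true
            then (1 : ℝ) else 0) := by
      intro u; split_ifs <;> norm_num
    simp only [h1]
    rw [Finset.sum_sub_distrib, ← Finset.mul_sum, sum_const, card_univ, Fintype.card_fun, Fintype.card_bool,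
      Fintype.card_fin, nsmul_eq_mul, mul_one, hW, natCast_card_filter]
    push_cast; ring
  have hmain : (2 : ℝ) ^ n - 2 * (W.card : ℝ) = (2 : ℝ) ^ n * ∑ E : ZMod 3, seg bell 0 n (vE bell n E) E := by
    rw [← hcount]; simp only [hsign]; exact hsigned
  have h2n : (0 : ℝ) < (2 : ℝ) ^ n := by positivity
  have hnum : 3 * (5 / 8 : ℝ) ^ 5 ≤ 1 / 3 := by norm_num
  nlinarith [mul_le_mul_of_nonneg_left htrace h2n.le, hmain, mul_le_mul_of_nonneg_left hnum h2n.le]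

end Count

/-! ### Back to the odd class -/

open Classical in
/-- **R0, dense branch**: for `#B ≥ 21`, `3·#{x odd : Rel x (tGuess x ⊕ 1_B)} ≤ 2·2^{N-1}`. -/
theorem fixedBells_dense_le (N : ℕ) (hN : 3 ≤ N) (B : Finset (Fin N)) (hB : 21 ≤ B.card) :
    3 * (univ.filter fun x : Fin N → Bool => OddZeros x ∧
        RingHLF.Rel x (fun k => xor (tGuess x k) (decide (k ∈ B)))).card ≤ 2 * 2 ^ (N - 1) := by
  obtain ⟨n, rfl⟩ : ∃ n, N = n + 1 := ⟨N - 1, by omega⟩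
  have hn : 2 ≤ n := by omega
  rw [Nat.add_sub_cancel]
  -- transport to u-coordinates: the transported strategy is the constant selector `[g ∈ B]`
  set z : (Fin (n + 1) → Bool) → (Fin (n + 1) → Bool) := fun x k => xor (tGuess x k) (decide (k ∈ B)) with hz
  have hy' : (fun (g : Fin (n + 1)) (u : Fin n → Bool) => xor (z (xOfU u) g) (tGuess (xOfU u) g)) =
      fun (g : Fin (n + 1)) (_ : Fin n → Bool) => decide (g ∈ B) := by
    funext g u
    simp only [hz]
    generalize tGuess (xOfU u) g = t
    generalize decide (g ∈ B) = d
    cases t <;> cases d <;> rfl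
  have hsub : (univ.filter fun x : Fin (n + 1) → Bool => OddZeros x ∧ Rel x (z x)) ⊆
      univ.filter fun x : Fin (n + 1) → Bool =>
        (univ.filter fun j : Fin (n + 1) => x j = false).card % 2 = 1 ∧
          ringWinU (n + 2) (fun (g : Fin (n + 1)) (_ : Fin n → Bool) => decide (g ∈ B)) (uVec x) = true := by
    intro x hx
    rw [mem_filter] at hx ⊢
    refine ⟨mem_univ _, hx.2.1, ?_⟩
    have h := (rel_iff_ringWinU hn x hx.2.1 z).1 hx.2.2
    rw [hy'] at h
    exact h
  have h1 := Finset.card_le_card hsub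
  have h2 := card_odd_filter_le hn
    (fun u : Fin n → Bool => ringWinU (n + 2) (fun (g : Fin (n + 1)) (_ : Fin n → Bool) => decide (g ∈ B)) u = true)
  have h3 := card_winU_dense_le B hB
  have h4 : (3 * ((univ.filter fun x : Fin (n + 1) → Bool => OddZeros x ∧ Rel x (z x)).card : ℕ) : ℝ) ≤
      ((2 * 2 ^ n : ℕ) : ℝ) := by
    push_cast
    have : ((univ.filter fun x : Fin (n + 1) → Bool => OddZeros x ∧ Rel x (z x)).card : ℝ) ≤
        ((univ.filter fun u : Fin n → Bool =>
          ringWinU (n + 2) (fun (g : Fin (n + 1)) (_ : Fin n → Bool) => decide (g ∈ B)) u = true).card : ℝ) := by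
      exact_mod_cast le_trans h1 h2
    linarith
  exact_mod_cast h4

end TransferWalk

end Summit.QuantumAdvantage.AdviceFreeQNC0

end
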